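import Literature.AnabelianGeometry.EtaleTheta.Discharge.Sec3Cor38StdIsoNotGL
import Literature.AnabelianGeometry.EtaleTheta.Discharge.Sec3Thm37Holds
import Literature.AnabelianGeometry.EtaleTheta.Discharge.Sec3Cor38PerfectionR
import Literature.AnabelianGeometry.EtaleTheta.Discharge.Sec3Cor38PerfectionMapTransport
import Literature.AlgebraicGeometry.Frobenioids.EquivalenceThm34OfThm34ii
import Literature.AlgebraicGeometry.Frobenioids.Thm42OfPreStepsGeneral
import HarnessLib

/-!
# [EtTh] Cor 3.8, proof rows C38-L02a, "`Ψ` preserves linear morphisms", C38-L04, C38-L06 — DISCHARGED at the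
# canonical [FrdI] vocabulary from the tree's PROVED [FrdI] Thm 3.4 (ii)/(iii)/(iv) (FACT-LIST rows F-2809, F-2815,
# F-2812, F-2816)

S. Mochizuki, *The étale theta function and its Frobenioid-theoretic manifestations*, Publ. RIMS **45** (2009)
[MochizukiEtTh2009], Cor. 3.8 "Preservation of Base-field-theoretic Morphisms and Hulls", proof, PDF p.81
(printed 307), l.1–8: "by [Mzk17], Theorem 3.4, (ii) … it follows that `Ψ` preserves pre-steps … By applying [Mzk17],
Theorem 3.4, (iv), in the case of assertion (i), and [Mzk17], Theorem 3.4, (ii); [Mzk17], Corollary 4.11, (ii), in the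
case of assertion (ii), it follows that `Ψ` preserves the submonoids '`O^▷(−)`'", and l.14–15: "Thus, `Ψ` preserves the
base-field-theoretic pre-steps" [cite: MochizukiEtTh2009, Cor 3.8 p.81]; S. Mochizuki, *The geometry of Frobenioids I*,
Kyushu J. Math. **62** (2008), Thm. 3.4 (ii)–(iv) pp.62–63 [cite: MochizukiFrdI2008, Thm. 3.4 (ii) p.62]
[cite: MochizukiFrdI2008, Thm. 3.4 (iv) p.63].

PROOF-ONLY companion (cell abc-iut, seat abc-iut-f-001, F fact-proving wave, tranches 133–134 of `plan/F-TRANCHES.tsv`)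
of the FROZEN statements-first sub-DAG `TemperedFrobenioidCor38Sub.lean` (seat abc-iut-w5-d124, p414329), rows
**F-2809** `Cor38Hyp.PreservesPreSteps` (C38-L02a), **F-2815** `PreservesLinear`, **F-2812** `PreservesOTri` (C38-L04),
**F-2816** `PreservesBsFldPreSteps` (C38-L06).  That file PROVED the first three from [FrdI] Thm. 3.4 (ii)/(iii)/(iv)
taken as BINDERS (`preservesPreSteps_of_thm34ii`, `preservesLinear_of_thm34iii`, `preservesOTri_of_thm34iv` /
`preservesOTri_of_baseSquare`), and w5-d124's `Sec3Cor38PerfectionMapTransport.lean` proved C38-L06 from C38-L02a +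
C38-L04 + C38-L05.  All those [FrdI] binders flow from the ONE 0-ary named fact `h34 := FrdI.Thm34ii` ([FrdI] Thm. 3.4 (ii),
2008 wording, FACT-LIST F-0711 — a THEOREM of the tree, `FrdI.Thm34ii_holds`, seats abc-iut-L1-t11 / L1-t13,
`EquivalencePreStepsFSMFF2008Assembly.lean` p427329; taken here BY NAME as a binder exactly as in abc-iut-w6-d039's
node-level assembly `Sec3Cor38iAssembly.lean`, because that module's olean is not yet served by the farm — the sequel
instantiates `h34 := FrdI.Thm34ii_holds`), (iii) and (iv) being its PROVED consequences
`FrdI.thm34iii_ofFunctor_of_thm34ii`, `FrdI.thm34iv_ofFunctor_of_thm34ii` (`EquivalenceThm34OfThm34ii.lean`); and the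
Frobenioid `C_i` of a tempered Frobenioid IS a Frobenioid at the canonical vocabulary `treeCatVocab`
(`TemperedFrobenioid.isFrobenioid_treeCatVocab_of_isMonoidOn`, [FrdI] Thm. 5.2 (ii)) modulo the single standing
residual of the L2 board `hBmon_i : IsMonoidOn C_i.ratFnFunctor` ("`𝔹` a monoid on `D`", [FrdI] Thm. 5.2 preamble).
Hence, at the canonical vocabulary and modulo `h34`, `hBmon₁`, `hBmon₂` (this file complements w6-d039's NODE-level
`cor38_i_of_thm34ii` by the ROW-level statements of the frozen FACT-LIST, and serves the Cor. 3.8 (ii) side):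

* **`preservesPreSteps_treeCatVocab`** (row F-2809) — Thm. 3.4 (ii) for `Ψ`, `Ψ⁻¹`; quasi-isotropic type from
  isotropic type (Thm. 3.7 (i), [FrdI] Rem. 3.1.1; `TemperedFrobenioid.data_isOfQuasiIsotropicType`); "`D_i` of
  FSMFF-type" is the field `h.fsmff`;
* **`preservesLinear_treeCatVocab`** (row F-2815) — Thm. 3.4 (iii) with (a) = row C38-L01 discharged by abc-iut-w5-d135
  (`standardIsotropicNotGroupLike_treeCatVocab`) and (b) VACUOUS (`C_i` not of group-like type, Thm. 3.7 (i));
* **`preservesOTri_treeCatVocab_of_isFrobeniusSlim`** (row F-2812, CASE (i) of Cor. 3.8: "`D_i` Frobenius-slim") —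
  Thm. 3.4 (iv); and `preservesOTri_treeCatVocab_of_baseSquares` (CASE (ii), from the base squares of [FrdI] Cor. 4.11
  (ii) — rows F-2813/F-2814, supplied over FSM-type bases by `Sec3Cor38BaseSquaresTreeVocab.lean` — and linearity);
* `isFrobeniusCompatible_treeCatVocab` / `…_inverse_…` — `Ψ`, `Ψ⁻¹` are compatible with arrows of Frobenius type
  (abc-iut-w5-d124's `isFrobeniusCompatible_of_preservesPreSteps`, now input-free modulo `hBmon_i`);
* **`preservesBsFldPreSteps_treeCatVocab_of_isFrobeniusSlim`** / **`…_of_baseSquares`** (row F-2816, C38-L06) — by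
  w5-d124's `preservesBsFldPreSteps_of_C_rows`, ALL of whose transport inputs are now theorems, so that C38-L06 holds
  modulo ONLY `hBmon_i` and the intrinsic-criterion row C38-L05 for `C₁`, `C₂` (`BsFldPreStepLimitCriterion`, F-2807 —
  not this file's) [+ the case hypothesis: Frobenius-slim bases, resp. the two base squares].

HONEST FRAMING: refereed pre-IUT material ([EtTh] §3 over [FrdI] §3–§5); the rows are proved AT THE CANONICAL VOCABULARY
(plan rule R5: the instance forms the Cor. 3.8 knits `cor38_i_of_rows` / `cor38_ii_of_rows` consume), modulo the
displayed hypotheses; nothing of either paper is restated or strengthened; no definition; nothing here bears on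
[IUTchIII] Cor. 3.12; typed ≠ proved elsewhere.
-/

namespace Literature.AnabelianGeometry.EtaleTheta

open CategoryTheory Opposite Literature.AlgebraicGeometry.Frobenioids

universe u₀ v₀ u v w

namespace Cor38Hyp

section TreeVocab

variable {D₀ : Type u₀} [Category.{v₀} D₀] {D₀' : Type u₀} [Category.{v₀} D₀']
  {T : RealifiedDivisorMonoids (D₀ := D₀) treeMonoidVocab.{w}}
  {T' : RealifiedDivisorMonoids (D₀ := D₀') treeMonoidVocab.{w}}
  {D : Type u} [Category.{v} D] {D' : Type u} [Category.{v} D']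
  {IsRational IsStrictlyRational : (Dᵒᵖ ⥤ CommMonCat.{w}) → Prop}
  {IsRational' IsStrictlyRational' : (D'ᵒᵖ ⥤ CommMonCat.{w}) → Prop}
  {C₁ : TemperedFrobenioid T D (treeCatVocab D IsRational IsStrictlyRational)}
  {C₂ : TemperedFrobenioid T' D' (treeCatVocab D' IsRational' IsStrictlyRational')}
  (h : Cor38Hyp C₁ C₂) (h34 : Literature.AlgebraicGeometry.Frobenioids.FrdI.Thm34ii.{w, v, max v w, u, max u w})

include h34

/-- **Row F-2809 / C38-L02a DISCHARGED at the canonical vocabulary** ("by [Mzk17], Theorem 3.4, (ii) … `Ψ` preserves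
pre-steps", p.81 l.2–3): `Ψ` and `Ψ⁻¹` carry pre-steps to pre-steps — [FrdI] Thm. 3.4 (ii) AS PRINTED
(the named fact `h34`) for the Frobenioids `C₁`, `C₂` (`isFrobenioid_treeCatVocab_of_isMonoidOn`), of
quasi-isotropic type because of isotropic type (Thm. 3.7 (i); [FrdI] Rem. 3.1.1), over `D_i` of FSMFF-type (`h.fsmff`);
modulo `h34`, `hBmon₁`, `hBmon₂`. [cite: MochizukiEtTh2009, Cor 3.8 p.81] -/
theorem preservesPreSteps_treeCatVocab (hBmon₁ : IsMonoidOn C₁.ratFnFunctor) (hBmon₂ : IsMonoidOn C₂.ratFnFunctor) :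
    h.PreservesPreSteps :=
  have hF₁ := C₁.isFrobenioid_treeCatVocab_of_isMonoidOn hBmon₁
  have hF₂ := C₂.isFrobenioid_treeCatVocab_of_isMonoidOn hBmon₂
  h.preservesPreSteps_of_thm34ii (h34 _ _ hF₁ hF₂ h.Ψ) (h34 _ _ hF₂ hF₁ h.Ψ.symm)
    (C₁.data_isOfQuasiIsotropicType hF₁) (C₂.data_isOfQuasiIsotropicType hF₂)

/-- **Row F-2815 DISCHARGED at the canonical vocabulary** ("`Ψ` preserves linear morphisms", the degree half of
"`Ψ` preserves `O^▷(−)`", p.81; [FrdI] Thm. 3.4 (iii)): for `Ψ` and `Ψ⁻¹` — [FrdI] Thm. 3.4 (iii)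
(`FrdI.thm34iii_ofFunctor_of_thm34ii` from `h34`) with (a) = row C38-L01 at the canonical vocabulary (abc-iut-w5-d135's
`standardIsotropicNotGroupLike_treeCatVocab`) and (b) vacuous (`C_i` not of group-like type, Thm. 3.7 (i)); modulo
`hBmon₁`, `hBmon₂`. [cite: MochizukiEtTh2009, Cor 3.8 p.81] -/
theorem preservesLinear_treeCatVocab (hBmon₁ : IsMonoidOn C₁.ratFnFunctor) (hBmon₂ : IsMonoidOn C₂.ratFnFunctor) :
    h.PreservesLinear :=
  have hF₁ := C₁.isFrobenioid_treeCatVocab_of_isMonoidOn hBmon₁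
  have hF₂ := C₂.isFrobenioid_treeCatVocab_of_isMonoidOn hBmon₂
  h.preservesLinear_of_thm34iii (FrdI.thm34iii_ofFunctor_of_thm34ii hF₁ hF₂ h.Ψ (h34 _ _ hF₁ hF₂ h.Ψ) (h34 _ _ hF₂ hF₁ h.Ψ.symm))
    (FrdI.thm34iii_ofFunctor_of_thm34ii hF₂ hF₁ h.Ψ.symm (h34 _ _ hF₂ hF₁ h.Ψ.symm) (h34 _ _ hF₁ hF₂ h.Ψ))
    (h.standardIsotropicNotGroupLike_treeCatVocab hBmon₁ hBmon₂)
    (fun h₁ _ => absurd h₁ C₁.opsData_not_isOfGroupLikeType)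
    (fun h₂ _ => absurd h₂ C₂.opsData_not_isOfGroupLikeType)

/-- **Row F-2812 / C38-L04, CASE (i), DISCHARGED at the canonical vocabulary** ("By applying [Mzk17], Theorem 3.4,
(iv), in the case of assertion (i) … `Ψ` preserves the submonoids '`O^▷(−)`'", p.81 l.5–8): for `D₁`, `D₂`
Frobenius-slim (the hypothesis of Cor. 3.8 (i)), `Ψ` and `Ψ⁻¹` carry `O^▷(A)` into `O^▷(ΨA)` — [FrdI] Thm. 3.4 (iv)
(`FrdI.thm34iv_ofFunctor_of_thm34ii` from `h34`), (a) = C38-L01, (b) vacuous; modulo `h34`, `hBmon₁`, `hBmon₂`. [cite: MochizukiEtTh2009, Cor 3.8 p.81] -/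
theorem preservesOTri_treeCatVocab_of_isFrobeniusSlim (hBmon₁ : IsMonoidOn C₁.ratFnFunctor)
    (hBmon₂ : IsMonoidOn C₂.ratFnFunctor) (hFs : IsFrobeniusSlim D) (hFs' : IsFrobeniusSlim D') :
    h.PreservesOTri :=
  have hF₁ := C₁.isFrobenioid_treeCatVocab_of_isMonoidOn hBmon₁
  have hF₂ := C₂.isFrobenioid_treeCatVocab_of_isMonoidOn hBmon₂
  h.preservesOTri_of_thm34iv (FrdI.thm34iv_ofFunctor_of_thm34ii hF₁ hF₂ h.Ψ (h34 _ _ hF₁ hF₂ h.Ψ) (h34 _ _ hF₂ hF₁ h.Ψ.symm))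
    (FrdI.thm34iv_ofFunctor_of_thm34ii hF₂ hF₁ h.Ψ.symm (h34 _ _ hF₂ hF₁ h.Ψ.symm) (h34 _ _ hF₁ hF₂ h.Ψ))
    (h.standardIsotropicNotGroupLike_treeCatVocab hBmon₁ hBmon₂)
    (fun h₁ _ => absurd h₁ C₁.opsData_not_isOfGroupLikeType)
    (fun h₂ _ => absurd h₂ C₂.opsData_not_isOfGroupLikeType) hFs hFs'

/-- **Row F-2812 / C38-L04, CASE (ii), at the canonical vocabulary, from the two base squares** ("[Mzk17], Theorem
3.4, (ii); [Mzk17], Corollary 4.11, (ii), in the case of assertion (ii)", p.81 l.6–8): given the `1`-unique `Ψ^Base`,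
`(Ψ⁻¹)^Base` of [FrdI] Cor. 4.11 (ii) (rows F-2813/F-2814; over Div-slim bases of FSM-type these are
`baseSquare(_Inv)_treeCatVocab_of_isOfFSMType`, `Sec3Cor38BaseSquaresTreeVocab.lean`), `Ψ`, `Ψ⁻¹` preserve `O^▷(−)`
= base-identity linear endomorphisms, linearity being `preservesLinear_treeCatVocab`; modulo `hBmon₁`, `hBmon₂`.
[cite: MochizukiEtTh2009, Cor 3.8 p.81] -/
theorem preservesOTri_treeCatVocab_of_baseSquares (hBmon₁ : IsMonoidOn C₁.ratFnFunctor)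
    (hBmon₂ : IsMonoidOn C₂.ratFnFunctor) (hsq : h.BaseSquare) (hsq' : h.BaseSquareInv) : h.PreservesOTri :=
  h.preservesOTri_of_baseSquare hsq hsq' (h.preservesLinear_treeCatVocab h34 hBmon₁ hBmon₂)

/-- **Row F-2810 / C38-L02b at the canonical vocabulary** ("by … [Mzk17], Theorem 4.2, (i), it follows that `Ψ`
preserves … primary steps", p.81 l.2–3): `Ψ` and `Ψ⁻¹` carry primary steps to primary steps — [FrdI] Thm. 4.2 (i) in
the tree's base-free form from pre-step preservation (abc-iut-w4-d105's `FrdI.T42.thm42i_ofFunctor_of_preservesPreSteps`,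
fed with row F-2809 and "`Φ_i` perf-factorial" = the field `isPerfFactorial` at `treeMonoidVocab`), in the setting
C38-L01 (abc-iut-w5-d135); modulo `h34`, `hBmon₁`, `hBmon₂`. [cite: MochizukiEtTh2009, Cor 3.8 p.81] -/
theorem preservesPrimarySteps_treeCatVocab (hBmon₁ : IsMonoidOn C₁.ratFnFunctor)
    (hBmon₂ : IsMonoidOn C₂.ratFnFunctor) : h.PreservesPrimarySteps :=
  have hF₁ := C₁.isFrobenioid_treeCatVocab_of_isMonoidOn hBmon₁
  have hF₂ := C₂.isFrobenioid_treeCatVocab_of_isMonoidOn hBmon₂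
  have hps := h.preservesPreSteps_treeCatVocab h34 hBmon₁ hBmon₂
  h.preservesPrimarySteps_of_thm42i
    (FrdI.T42.thm42i_ofFunctor_of_preservesPreSteps (Ψ := h.Ψ) hF₁ hF₂ (fun A => C₁.isPerfFactorial (op A))
      (fun A => C₂.isPerfFactorial (op A)) hps.1 hps.2)
    (FrdI.T42.thm42i_ofFunctor_of_preservesPreSteps (Ψ := h.Ψ.symm) hF₂ hF₁ (fun A => C₂.isPerfFactorial (op A))
      (fun A => C₁.isPerfFactorial (op A)) hps.2 hps.1)
    (h.standardIsotropicNotGroupLike_treeCatVocab hBmon₁ hBmon₂)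

/-- **C38-L03′ (the structure-compatible perfection square, abc-iut-w5-d124's `CompatibleWithPerfectionR`) at the
canonical vocabulary modulo `hBmon₁`, `hBmon₂` only** ("`Ψ` is compatible with the operation of passing to the
perfection [cf. [Mzk17], Theorem 3.4, (iii)]", p.81 l.3–4) — `compatibleWithPerfectionR_of_preservesPreSteps` fed with row
F-2809.  (The FROZEN row F-2811 `CompatibleWithPerfection P₁ P₂` quantifies over data-only `PerfectionData` and asks
bare `1`-uniqueness, whose [FrdI] template `Thm34iii_pf` is kernel-refuted in the tree, `not_thm34iii_pf`; the R-form is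
the one proved.) [cite: MochizukiEtTh2009, Cor 3.8 p.81] -/
theorem compatibleWithPerfectionR_treeCatVocab (hBmon₁ : IsMonoidOn C₁.ratFnFunctor)
    (hBmon₂ : IsMonoidOn C₂.ratFnFunctor) :
    h.CompatibleWithPerfectionR (C₁.isFrobenioid_treeCatVocab_of_isMonoidOn hBmon₁)
      (C₂.isFrobenioid_treeCatVocab_of_isMonoidOn hBmon₂) :=
  h.compatibleWithPerfectionR_of_preservesPreSteps _ _ (h.preservesPreSteps_treeCatVocab h34 hBmon₁ hBmon₂)

/-- `Ψ` is compatible with arrows of Frobenius type (the input of the perfection functor `Ψ^pf`, [FrdI] Thm. 3.4 (iii),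
p.81 l.3–4), at the canonical vocabulary modulo `hBmon₁`, `hBmon₂` only — abc-iut-w5-d124's
`isFrobeniusCompatible_of_preservesPreSteps` fed with row F-2809. [cite: MochizukiEtTh2009, Cor 3.8 p.81] -/
theorem isFrobeniusCompatible_treeCatVocab (hBmon₁ : IsMonoidOn C₁.ratFnFunctor)
    (hBmon₂ : IsMonoidOn C₂.ratFnFunctor) :
    PreFrobenioid.IsFrobeniusCompatible C₁.toElem C₂.toElem h.Ψ.functor :=
  h.isFrobeniusCompatible_of_preservesPreSteps (C₁.isFrobenioid_treeCatVocab_of_isMonoidOn hBmon₁)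
    (C₂.isFrobenioid_treeCatVocab_of_isMonoidOn hBmon₂) (h.preservesPreSteps_treeCatVocab h34 hBmon₁ hBmon₂)

/-- The same for `Ψ⁻¹`. [cite: MochizukiEtTh2009, Cor 3.8 p.81] -/
theorem isFrobeniusCompatible_inverse_treeCatVocab (hBmon₁ : IsMonoidOn C₁.ratFnFunctor)
    (hBmon₂ : IsMonoidOn C₂.ratFnFunctor) :
    PreFrobenioid.IsFrobeniusCompatible C₂.toElem C₁.toElem h.Ψ.inverse :=
  h.isFrobeniusCompatible_inverse_of_preservesPreSteps (C₁.isFrobenioid_treeCatVocab_of_isMonoidOn hBmon₁)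
    (C₂.isFrobenioid_treeCatVocab_of_isMonoidOn hBmon₂) (h.preservesPreSteps_treeCatVocab h34 hBmon₁ hBmon₂)

/-- **Row F-2816 / C38-L06 at the canonical vocabulary, CASE (i)** ("Thus, `Ψ` preserves the base-field-theoretic
pre-steps", p.81 l.14–15): for `D₁`, `D₂` Frobenius-slim, `Ψ` and `Ψ⁻¹` preserve the base-field-theoretic pre-steps,
modulo `hBmon₁`, `hBmon₂` and the intrinsic criterion C38-L05 for `C₁`, `C₂` (`BsFldPreStepLimitCriterion` at THE
perfections; row F-2807, not discharged here) — abc-iut-w5-d124's transport `preservesBsFldPreSteps_of_C_rows` with its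
inputs C38-L02a (`preservesPreSteps_treeCatVocab`), C38-L04 (`preservesOTri_treeCatVocab_of_isFrobeniusSlim`) and the
Frobenius-compatibility of `Ψ`, `Ψ⁻¹` now THEOREMS. [cite: MochizukiEtTh2009, Cor 3.8 p.81] -/
theorem preservesBsFldPreSteps_treeCatVocab_of_isFrobeniusSlim (hBmon₁ : IsMonoidOn C₁.ratFnFunctor)
    (hBmon₂ : IsMonoidOn C₂.ratFnFunctor) (hFs : IsFrobeniusSlim D) (hFs' : IsFrobeniusSlim D')
    (h5₁ : C₁.BsFldPreStepLimitCriterion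
      (PreFrobenioidData.perfection (C₁.isFrobenioid_treeCatVocab_of_isMonoidOn hBmon₁)))
    (h5₂ : C₂.BsFldPreStepLimitCriterion
      (PreFrobenioidData.perfection (C₂.isFrobenioid_treeCatVocab_of_isMonoidOn hBmon₂))) :
    h.PreservesBsFldPreSteps :=
  h.preservesBsFldPreSteps_of_C_rows (C₁.isFrobenioid_treeCatVocab_of_isMonoidOn hBmon₁)
    (C₂.isFrobenioid_treeCatVocab_of_isMonoidOn hBmon₂) (h.isFrobeniusCompatible_treeCatVocab h34 hBmon₁ hBmon₂)
    (h.isFrobeniusCompatible_inverse_treeCatVocab h34 hBmon₁ hBmon₂) (h.preservesPreSteps_treeCatVocab h34 hBmon₁ hBmon₂)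
    (h.preservesOTri_treeCatVocab_of_isFrobeniusSlim h34 hBmon₁ hBmon₂ hFs hFs') h5₁ h5₂

/-- **Row F-2816 / C38-L06 at the canonical vocabulary, CASE (ii)**: given the two base squares of [FrdI] Cor. 4.11
(ii) (rows F-2813/F-2814), `Ψ` and `Ψ⁻¹` preserve the base-field-theoretic pre-steps, modulo `hBmon₁`, `hBmon₂` and
C38-L05 for `C₁`, `C₂`. [cite: MochizukiEtTh2009, Cor 3.8 p.81] -/
theorem preservesBsFldPreSteps_treeCatVocab_of_baseSquares (hBmon₁ : IsMonoidOn C₁.ratFnFunctor)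
    (hBmon₂ : IsMonoidOn C₂.ratFnFunctor) (hsq : h.BaseSquare) (hsq' : h.BaseSquareInv)
    (h5₁ : C₁.BsFldPreStepLimitCriterion
      (PreFrobenioidData.perfection (C₁.isFrobenioid_treeCatVocab_of_isMonoidOn hBmon₁)))
    (h5₂ : C₂.BsFldPreStepLimitCriterion
      (PreFrobenioidData.perfection (C₂.isFrobenioid_treeCatVocab_of_isMonoidOn hBmon₂))) :
    h.PreservesBsFldPreSteps :=
  h.preservesBsFldPreSteps_of_C_rows (C₁.isFrobenioid_treeCatVocab_of_isMonoidOn hBmon₁)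
    (C₂.isFrobenioid_treeCatVocab_of_isMonoidOn hBmon₂) (h.isFrobeniusCompatible_treeCatVocab h34 hBmon₁ hBmon₂)
    (h.isFrobeniusCompatible_inverse_treeCatVocab h34 hBmon₁ hBmon₂) (h.preservesPreSteps_treeCatVocab h34 hBmon₁ hBmon₂)
    (h.preservesOTri_treeCatVocab_of_baseSquares h34 hBmon₁ hBmon₂ hsq hsq') h5₁ h5₂

end TreeVocab

end Cor38Hyp

end Literature.AnabelianGeometry.EtaleTheta
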